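import Summits.HodgeConjecture.HodgeCM.PerL34.FockPkIrreducible_1

/-! PORT of `HodgeCM/PerL34/FockPkIrreducible.lean` (HodgeCMPerL run 82) — part 2: continuation of `Summits.HodgeConjecture.HodgeCM.PerL34.FockPkIrreducible_1` (split at a top-level declaration boundary by port_pkg.py; scope re-opened below; declarations unchanged). -/

-- port_pkg: scope re-opened for this part (file-level context, then the namespace/section stack open at the cut)
set_option autoImplicit false
noncomputable section
open MeasureTheory Complex MvPolynomial Matrix
open scoped Real ComplexConjugate InnerProductSpace
namespace HodgeCM.PerL34.Fock.Hermite
variable {σ : Type*} [Fintype σ] [DecidableEq σ]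
/-- Step 2 iterated (CONCENTRATION).  If `W` is `U(σ)`-stable and `ζ_α ∈ W` then `ζ_{|α|·e_{i₀}} ∈ W`. -/
theorem fockBasis_single_mem {W : Submodule ℂ (FockL2 σ)}
    (hW : ∀ U : Matrix.unitaryGroup σ ℂ, ∀ x ∈ W, fockRep U x ∈ W) (i₀ : σ) :
    ∀ (n : ℕ) (α : σ →₀ ℕ), (α.support.erase i₀).card = n →
      (fockBasis α : FockL2 σ) ∈ W → (fockBasis (Finsupp.single i₀ (mdeg α)) : FockL2 σ) ∈ W := by
  intro n
  induction n using Nat.strong_induction_on with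
  | _ n ih =>
  intro α hn hα
  by_cases h0 : α.support.erase i₀ = ∅
  · have hsupp : ∀ l, l ≠ i₀ → α l = 0 := by
      intro l hl
      by_contra hne
      have h1 : l ∈ α.support.erase i₀ := Finset.mem_erase.mpr ⟨hl, Finsupp.mem_support_iff.mpr hne⟩
      rw [h0] at h1
      exact Finset.notMem_empty l h1
    have hαeq : Finsupp.single i₀ (mdeg α) = α := by
      ext l
      rw [Finsupp.single_apply]
      by_cases hl : i₀ = l
      · subst hl
        rw [if_pos rfl, mdeg, Finset.sum_eq_single i₀ (fun m _ hm => hsupp m hm)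
          (fun h => absurd (Finset.mem_univ _) h)]
      · rw [if_neg hl, hsupp l (Ne.symm hl)]
    rw [hαeq]
    exact hα
  · obtain ⟨j, hj⟩ := Finset.nonempty_of_ne_empty h0
    obtain ⟨hji, hjs⟩ := Finset.mem_erase.mp hj
    have hij : i₀ ≠ j := Ne.symm hji
    have hstep := fockBasis_merge_mem hW hij hα
    have hsub : (merge i₀ j α).support.erase i₀ ⊆ (α.support.erase i₀).erase j := by
      intro l hl
      obtain ⟨hli, hls⟩ := Finset.mem_erase.mp hl
      have hlj : l ≠ j := fun h => Finsupp.mem_support_iff.mp hls (by rw [h, merge_apply_j hij])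
      refine Finset.mem_erase.mpr ⟨hlj, Finset.mem_erase.mpr ⟨hli, Finsupp.mem_support_iff.mpr ?_⟩⟩
      rw [← merge_apply_other hli hlj α]
      exact Finsupp.mem_support_iff.mp hls
    have hlt : ((merge i₀ j α).support.erase i₀).card < n := by
      rw [← hn]
      exact lt_of_le_of_lt (Finset.card_le_card hsub) (Finset.card_erase_lt_of_mem hj)
    have h2 := ih _ hlt (merge i₀ j α) rfl hstep
    rwa [mdeg_merge hij] at h2

/-! ## §3  Orthogonal complements and the theorem -/

/-- The orthogonal complement of a `U(σ)`-stable subspace is `U(σ)`-stable (unitarity of `ν₀`). -/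
theorem orthogonal_stable {W : Submodule ℂ (FockL2 σ)}
    (hW : ∀ U : Matrix.unitaryGroup σ ℂ, ∀ x ∈ W, fockRep U x ∈ W) (U : Matrix.unitaryGroup σ ℂ)
    {y : FockL2 σ} (hy : y ∈ Wᗮ) : fockRep U y ∈ Wᗮ := by
  rw [Submodule.mem_orthogonal] at hy ⊢
  intro w hw
  have h1 : fockRep U (fockRep U⁻¹ w) = w := by
    rw [map_inv, LinearIsometryEquiv.coe_inv, LinearIsometryEquiv.apply_symm_apply]
  rw [← h1, LinearIsometryEquiv.inner_map_map]
  exact hy _ (hW U⁻¹ w hw)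

/-- **[Fo89 p. 182 L39] "each $\mathcal{P}_k$ is irreducible under the action of U(n)"** — on the genuine `L²`
Fock space: a `U(σ)`-stable subspace of `𝓟ₖ = degSpan {k}` is `⊥` or `𝓟ₖ`. -/
theorem degSpan_singleton_irreducible (k : ℕ) (W : Submodule ℂ (FockL2 σ)) (hWk : W ≤ degSpan ({k} : Set ℕ))
    (hW : ∀ U : Matrix.unitaryGroup σ ℂ, ∀ x ∈ W, fockRep U x ∈ W) :
    W = ⊥ ∨ W = degSpan ({k} : Set ℕ) := by
  classical
  by_cases hbot : W = ⊥
  · exact Or.inl hbot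
  right
  by_contra hne
  haveI : FiniteDimensional ℂ W := Submodule.finiteDimensional_of_le hWk
  haveI : CompleteSpace W := FiniteDimensional.complete ℂ W
  have hsup : W ⊔ Wᗮ ⊓ degSpan ({k} : Set ℕ) = degSpan ({k} : Set ℕ) :=
    Submodule.sup_orthogonal_inf_of_hasOrthogonalProjection hWk
  have hW'ne : Wᗮ ⊓ degSpan ({k} : Set ℕ) ≠ ⊥ := by
    intro h
    apply hne
    rw [← hsup, h, sup_bot_eq]
  have hW'stab : ∀ U : Matrix.unitaryGroup σ ℂ, ∀ x ∈ Wᗮ ⊓ degSpan ({k} : Set ℕ),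
      fockRep U x ∈ Wᗮ ⊓ degSpan ({k} : Set ℕ) :=
    fun U x hx => ⟨orthogonal_stable hW U hx.1, homogeneousSpan_invariant k U hx.2⟩
  obtain ⟨w, hwW, hw0⟩ := (Submodule.ne_bot_iff W).mp hbot
  obtain ⟨w', hw'W', hw'0⟩ := (Submodule.ne_bot_iff _).mp hW'ne
  obtain ⟨β, hβk, hβW⟩ := exists_fockBasis_mem (fun t x hx => hW (diagHom t) x hx) hWk hwW hw0
  obtain ⟨β', hβ'k, hβ'W'⟩ :=
    exists_fockBasis_mem (fun t x hx => hW'stab (diagHom t) x hx) inf_le_right hw'W' hw'0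
  have key : ∃ γ : σ →₀ ℕ, (fockBasis γ : FockL2 σ) ∈ W ∧ (fockBasis γ : FockL2 σ) ∈ Wᗮ ⊓ degSpan ({k} : Set ℕ) := by
    by_cases hk : k = 0
    · have h1 : β = 0 := (mdeg_eq_zero_iff β).mp (hβk.trans hk)
      have h2 : β' = 0 := (mdeg_eq_zero_iff β').mp (hβ'k.trans hk)
      rw [h1] at hβW
      rw [h2] at hβ'W'
      exact ⟨0, hβW, hβ'W'⟩
    · have hβ0 : β ≠ 0 := fun h => hk (by rw [← hβk, h]; exact (mdeg_eq_zero_iff 0).mpr rfl)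
      obtain ⟨i₀, -⟩ := Finset.nonempty_of_ne_empty (mt Finsupp.support_eq_empty.mp hβ0)
      refine ⟨Finsupp.single i₀ k, ?_, ?_⟩
      · have h3 := fockBasis_single_mem hW i₀ _ β rfl hβW
        rwa [hβk] at h3
      · have h3 := fockBasis_single_mem hW'stab i₀ _ β' rfl hβ'W'
        rwa [hβ'k] at h3
  obtain ⟨γ, hγW, hγW'⟩ := key
  have hinner : ⟪(fockBasis γ : FockL2 σ), (fockBasis γ : FockL2 σ)⟫_ℂ = 0 :=
    Submodule.inner_right_of_mem_orthogonal hγW hγW'.1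
  have hzero : (fockBasis γ : FockL2 σ) = 0 := inner_self_eq_zero.mp hinner
  have hnorm : ‖(fockBasis γ : FockL2 σ)‖ = 1 := fockBasis.orthonormal.1 γ
  rw [hzero, norm_zero] at hnorm
  exact zero_ne_one hnorm

/-! ## §4  The same in the Schrödinger model `L²(ℝ^σ)`, through `μ(𝒜) = B⁻¹ν(𝒜_c)B` [Fo89 p. 162 L5] -/

/-- The degree-`k` Hermite piece `𝓗ₖ ⊂ L²(ℝ^σ)`: the span of the Hermite functions `h_α`, `|α| = k`
(`h_α = B⁻¹ζ_α`, [Fo89 p. 45 L45]; `FockBargmann.bargmann_hermiteL2`). -/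
def hermDegSpan (k : ℕ) : Submodule ℂ (Lp ℂ 2 (volume : Measure (σ → ℝ))) :=
  Submodule.span ℂ ((fun α : σ →₀ ℕ => hermiteL2 α) '' {α | mdeg α ∈ ({k} : Set ℕ)})

/-- `B 𝓗ₖ = 𝓟ₖ`. -/
theorem map_bargmann_hermDegSpan (k : ℕ) :
    (hermDegSpan k).map (bargmann (σ := σ)).toLinearEquiv.toLinearMap = degSpan ({k} : Set ℕ) := by
  rw [hermDegSpan, degSpan, Submodule.map_span, ← Set.image_comp]
  congr 1
  refine Set.image_congr fun α _ => ?_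
  show bargmann (hermiteL2 α) = (fockBasis α : FockL2 σ)
  rw [bargmann_hermiteL2, fockBasis_apply]

/-- `B f ∈ 𝓟ₖ ↔ f ∈ 𝓗ₖ`. -/
theorem bargmann_mem_degSpan_iff (k : ℕ) (f : Lp ℂ 2 (volume : Measure (σ → ℝ))) :
    bargmann f ∈ degSpan ({k} : Set ℕ) ↔ f ∈ hermDegSpan k := by
  rw [← map_bargmann_hermDegSpan, Submodule.mem_map_equiv]
  show bargmann.symm (bargmann f) ∈ hermDegSpan k ↔ f ∈ hermDegSpan k
  rw [LinearIsometryEquiv.symm_apply_apply]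

/-- **[Fo89 p. 182 L39] in the Schrödinger model**: a subspace of the degree-`k` Hermite piece `𝓗ₖ ⊂ L²(ℝ^σ)`
stable under all the transported operators `schrodingerU U = B⁻¹ ν₀(U) B` (`U ∈ U(σ)`; Folland's `μ(𝒜)`,
`𝒜 ∈ Sp ∩ O(2n)`, up to the discarded scalar `det^{-1/2}` [p. 162 L1], which changes no invariant subspace) is
`⊥` or `𝓗ₖ`. -/
theorem hermDegSpan_irreducible (k : ℕ) (W : Submodule ℂ (Lp ℂ 2 (volume : Measure (σ → ℝ))))
    (hWk : W ≤ hermDegSpan k)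
    (hW : ∀ U : Matrix.unitaryGroup σ ℂ, ∀ f ∈ W, schrodingerU U f ∈ W) :
    W = ⊥ ∨ W = hermDegSpan k := by
  have hinj : Function.Injective
      (Submodule.map (bargmann (σ := σ)).toLinearEquiv.toLinearMap) :=
    Submodule.map_injective_of_injective fun a b hab => (bargmann (σ := σ)).injective hab
  have hW'k : W.map (bargmann (σ := σ)).toLinearEquiv.toLinearMap ≤
      degSpan ({k} : Set ℕ) := by
    rw [← map_bargmann_hermDegSpan]
    exact Submodule.map_mono hWk
  have hW'stab : ∀ U : Matrix.unitaryGroup σ ℂ,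
      ∀ x ∈ W.map (bargmann (σ := σ)).toLinearEquiv.toLinearMap,
        fockRep U x ∈ W.map (bargmann (σ := σ)).toLinearEquiv.toLinearMap := by
    intro U x hx
    rw [Submodule.mem_map_equiv] at hx ⊢
    have h1 : bargmann.toLinearEquiv.symm (fockRep U x) = schrodingerU U (bargmann.toLinearEquiv.symm x) := by
      show bargmann.symm (fockRep U x) = schrodingerU U (bargmann.symm x)
      rw [schrodingerU_apply, LinearIsometryEquiv.apply_symm_apply]
    rw [h1]
    exact hW U _ hx
  rcases degSpan_singleton_irreducible k _ hW'k hW'stab with h | h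
  · left
    apply hinj
    rw [Submodule.map_bot]
    exact h
  · right
    apply hinj
    rw [map_bargmann_hermDegSpan]
    exact h

end HodgeCM.PerL34.Fock.Hermite

end
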